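import Literature.NumberTheory.Automorphic.UnitaryGroupArthurTraceTwoSockets
import Literature.NumberTheory.Automorphic.UnitaryGroupHyperbolicSocketClosedTwo
import HarnessLib

/-!
# `J(f)` on the quasi-split `U(J₂)` of a CM field with the two Borel sockets CLOSED (parts-free skeleton):
# `J(f) = Σ_elliptic c_μ Σ' vol·Φ + Σ_central B_c(ζ_i) − c_μ·C_w·Σ_hyperbolic J^v(γ_i, f)`
(Rogawski, *Automorphic Representations of Unitary Groups in Three Variables* (1990), §2.3 p. 14 «`J(f) = Σ_𝔬 J_𝔬(f)`»,
§6.1 (6.1.3), §7.3 Prop. 7.3.1 («Let `G = U(3)`, `U(2)`, or `U(2) × U(1)`»); Arthur, *A trace formula for reductive groups I*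
(1978), §8.)

Topic `NumberTheory/Automorphic`; namespace `Literature.NumberTheory.Automorphic.UnitaryGroup`. THEOREMS ONLY over accepted tree
modules (no definition, no named fact, no instance, no notation, no `sorry`). H-SIDE copy of LAWS 1–5 (`H = U(Φ₂) × U(Φ₁)`,
rank-one factor `U(J₂)`) of the T1 line `Cruxes/H413/Lines/F0_T1InnerFormTraceIdentity.lean` (cell `pub/hodgecm-mathlib`, crux
H413; census `CENSUS-LAWS-Hside.F0P3a-p03g6.md`; PEN-#1 LETTER WORD #7): row (L5-ω) at `N = 2`, the `N = 2` sibling of ★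
`UnitaryGroupArthurTraceThreeSocketsClosed` with the SINGULAR summand DELETED (there is no singular type `d(a,b,a)` in rank one,
★ `UnitaryGroupCharpolyBorelClassesTwo`).

THE SOCKET ★ `arthurTrace_eq_sum_orbital_add_sum_central_add_sum_hyperbolic_cm_two` (`UnitaryGroupArthurTraceTwoSockets`) writes
Arthur's `J(f)` on `U(J₂)` as the elliptic orbital sum plus `Σ p_i(0)` over the CENTRAL and the REGULAR HYPERBOLIC Borel-refined
classes of the live set `S♭_f`, for one family `P` of class polynomials with `J^T_i(f) = (P i)(log T)` for `T ≫ 0`. A «finset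
closer» for a socket is a theorem of the shape
`∀ S P, (∀ i ∈ S, ∃ T₀, ∀ T > T₀, J^T_i(f) = (P i)(log T)) → ∃ rep, Σ_{i ∈ S.filter socket} (P i)(0) = Σ_{i ∈ S.filter socket} B(rep i)`
with `B` an EXPLICIT value indexed by a representative of the class (★ `exists_rep_sum_filter_hyperbolic_classPolynomial_eval_zero_cm_two`
of `UnitaryGroupHyperbolicSocketClosedTwo` is the hyperbolic one: `B(γ) = −c_μ·C_w·J^v(γ, f)`, Rogawski (6.1.3); ★
`exists_rep_sum_filter_central_classPolynomial_eval_zero_two` of `UnitaryGroupCentralSocketClosedTwo` the central one).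

* **`arthurTrace_eq_orbital_add_central_add_hyperbolic_of_closers_cm_two`** — THE ASSEMBLY, PARTS-FREE in the central closer:
  for ANY key type `κc`, values `Bc : κc → ℂ` and closer `closerC` of the above shape (the letters of the central × unipotent row
  [Prop. 7.3.1] enter ONLY through `Bc`), and the hyperbolic window data `(ρ, w, C_w)` of ★: there are representatives
  `zrep, hyrep` with `J(f) = (elliptic orbital sum of ★) + Σ_{central} Bc(zrep i) + Σ_{hyperbolic} −(c_μ·C_w·J^v(hyrep i, f))`.
  The explicit edition (`κc := ↥(ratOne L⁺ L conj)`, `Bc := B_unip` from the central head's `_cm` pin) is the companion file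
  `UnitaryGroupArthurTraceExplicitCMTwo` once that pin lands.

HC_CM is proved only modulo the 7 printed citations until rung 0 closes — nothing here bears on a summit statement.

## References
* J. D. Rogawski, *Automorphic Representations of Unitary Groups in Three Variables*, Ann. of Math. Stud. 123 (1990), §2.3 (p. 14),
  §6.1 (pp. 79–80), §7.3 (pp. 97–98) [Rogawski1990].
* J. Arthur, *A trace formula for reductive groups I*, Duke Math. J. 45 (1978), §8 [Arthur1978TraceFormulaI].
-/

set_option autoImplicit false

noncomputable section

open MeasureTheory Measure NumberField IsDedekindDomain Set Matrix Polynomial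
open Literature.MeasureTheory.Group
open scoped NNReal ENNReal Classical MatrixGroups

namespace Literature.NumberTheory.Automorphic

namespace UnitaryGroup

/-- **`J(f)` on `U(J₂)` with the two Borel sockets closed, parts-free in the central closer.** Given the window data of the
hyperbolic row and a finset closer for the central socket with values `Bc` indexed by an arbitrary key type, Arthur's `J(f)` on the
quasi-split `U(J₂)` of the CM field `L` is the elliptic orbital sum of ★
`arthurTrace_eq_sum_orbital_add_sum_central_add_sum_hyperbolic_cm_two` plus `Σ_{central} Bc(zrep i) − c_μ·C_w·Σ_{hyperbolic} J^v(hyrep i, f)`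
for suitable representatives (the socket's class polynomials `P` fed to the two closers). [cite: Rogawski1990, §2.3 (p. 14)]
[cite: Rogawski1990, §6.1 (6.1.3)] [cite: Arthur1978TraceFormulaI, §8] -/
theorem arthurTrace_eq_orbital_add_central_add_hyperbolic_of_closers_cm_two (L : Type) [Field L] [NumberField L] [IsCMField L]
    [instMA : MeasurableSpace (quasiSplit (↥(maximalRealSubfield L)) L (IsCMField.complexConj L) 2).Adelic] [instBA : BorelSpace (quasiSplit (↥(maximalRealSubfield L)) L (IsCMField.complexConj L) 2).Adelic]
    (ν : Measure (quasiSplit (↥(maximalRealSubfield L)) L (IsCMField.complexConj L) 2).Adelic) [instν : IsHaarMeasure ν]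
    (μ : Measure (quasiSplit (↥(maximalRealSubfield L)) L (IsCMField.complexConj L) 2).automorphicQuotient)
    [instμ : (quasiSplit (↥(maximalRealSubfield L)) L (IsCMField.complexConj L) 2).IsAutomorphicMeasure μ]
    [instMU : MeasurableSpace (adelicUnipotent (↥(maximalRealSubfield L)) L (IsCMField.complexConj L) 2)]
    [instBU : BorelSpace (adelicUnipotent (↥(maximalRealSubfield L)) L (IsCMField.complexConj L) 2)]
    [instMQ : ∀ γ : (quasiSplit (↥(maximalRealSubfield L)) L (IsCMField.complexConj L) 2).Adelic,
      MeasurableSpace ((quasiSplit (↥(maximalRealSubfield L)) L (IsCMField.complexConj L) 2).Adelic ⧸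
        Subgroup.centralizer ({γ} : Set (quasiSplit (↥(maximalRealSubfield L)) L (IsCMField.complexConj L) 2).Adelic))]
    [instBQ : ∀ γ : (quasiSplit (↥(maximalRealSubfield L)) L (IsCMField.complexConj L) 2).Adelic,
      BorelSpace ((quasiSplit (↥(maximalRealSubfield L)) L (IsCMField.complexConj L) 2).Adelic ⧸
        Subgroup.centralizer ({γ} : Set (quasiSplit (↥(maximalRealSubfield L)) L (IsCMField.complexConj L) 2).Adelic))]
    [instMS : ∀ γ : (quasiSplit (↥(maximalRealSubfield L)) L (IsCMField.complexConj L) 2).Adelic,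
      MeasurableSpace (↥(Subgroup.centralizer ({γ} : Set (quasiSplit (↥(maximalRealSubfield L)) L (IsCMField.complexConj L) 2).Adelic)) ⧸
        ((quasiSplit (↥(maximalRealSubfield L)) L (IsCMField.complexConj L) 2).quotientSubgroup ⊓
          Subgroup.centralizer ({γ} : Set (quasiSplit (↥(maximalRealSubfield L)) L (IsCMField.complexConj L) 2).Adelic)).subgroupOf
          (Subgroup.centralizer ({γ} : Set (quasiSplit (↥(maximalRealSubfield L)) L (IsCMField.complexConj L) 2).Adelic)))]
    [instBS : ∀ γ : (quasiSplit (↥(maximalRealSubfield L)) L (IsCMField.complexConj L) 2).Adelic,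
      BorelSpace (↥(Subgroup.centralizer ({γ} : Set (quasiSplit (↥(maximalRealSubfield L)) L (IsCMField.complexConj L) 2).Adelic)) ⧸
        ((quasiSplit (↥(maximalRealSubfield L)) L (IsCMField.complexConj L) 2).quotientSubgroup ⊓
          Subgroup.centralizer ({γ} : Set (quasiSplit (↥(maximalRealSubfield L)) L (IsCMField.complexConj L) 2).Adelic)).subgroupOf
          (Subgroup.centralizer ({γ} : Set (quasiSplit (↥(maximalRealSubfield L)) L (IsCMField.complexConj L) 2).Adelic)))]
    (ν₀ : Measure (adelicUnipotent (↥(maximalRealSubfield L)) L (IsCMField.complexConj L) 2)) [instν₀ : ν₀.IsHaarMeasure]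
    (𝓕 : Set (adelicUnipotent (↥(maximalRealSubfield L)) L (IsCMField.complexConj L) 2))
    (h𝓕 : IsFundamentalDomain (rationalUnipotent (↥(maximalRealSubfield L)) L (IsCMField.complexConj L) 2) 𝓕 ν₀)
    (rep : ConjClasses ↥(quasiSplit (↥(maximalRealSubfield L)) L (IsCMField.complexConj L) 2).arithmeticSubgroup → ↥(quasiSplit (↥(maximalRealSubfield L)) L (IsCMField.complexConj L) 2).arithmeticSubgroup)
    (hrep : ∀ s, ConjClasses.mk (rep s) = s)
    (νC : ∀ s : ConjClasses ↥(quasiSplit (↥(maximalRealSubfield L)) L (IsCMField.complexConj L) 2).arithmeticSubgroup,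
      Measure ↥(Subgroup.centralizer ({((rep s : ↥(quasiSplit (↥(maximalRealSubfield L)) L (IsCMField.complexConj L) 2).arithmeticSubgroup) : (quasiSplit (↥(maximalRealSubfield L)) L (IsCMField.complexConj L) 2).Adelic)} : Set (quasiSplit (↥(maximalRealSubfield L)) L (IsCMField.complexConj L) 2).Adelic)))
    [instνC : ∀ s, IsHaarMeasure (νC s)]
    (f : (quasiSplit (↥(maximalRealSubfield L)) L (IsCMField.complexConj L) 2).Adelic → ℂ)
    (hf : IsQuasiSplitTest (↥(maximalRealSubfield L)) L (IsCMField.complexConj L) 2 f)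
    [MeasurableSpace ((quasiSplit (↥(maximalRealSubfield L)) L (IsCMField.complexConj L) 2).Adelic ⧸
      torusAdelic (↥(maximalRealSubfield L)) L (IsCMField.complexConj L) 2)]
    [BorelSpace ((quasiSplit (↥(maximalRealSubfield L)) L (IsCMField.complexConj L) 2).Adelic ⧸
      torusAdelic (↥(maximalRealSubfield L)) L (IsCMField.complexConj L) 2)]
    (ρ : Measure ↥(torusAdelic (↥(maximalRealSubfield L)) L (IsCMField.complexConj L) 2)) [ρ.IsHaarMeasure] [ρ.IsInvInvariant]
    {w : (quasiSplit (↥(maximalRealSubfield L)) L (IsCMField.complexConj L) 2).Rational}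
    (hw : ((w.1 : GL (Fin 2) L) : Matrix (Fin 2) (Fin 2) L) = !![(0 : L), 1; 1, 0])
    {Cw : ℝ≥0∞} (hC : Cw ≠ ⊤)
    (hwin : ∀ β' : torusInBorel (↥(maximalRealSubfield L)) L (IsCMField.complexConj L) 2 → ℝ≥0∞,
        IsCoveringWeight ((rationalBorel (↥(maximalRealSubfield L)) L (IsCMField.complexConj L) 2).subgroupOf
          (torusInBorel (↥(maximalRealSubfield L)) L (IsCMField.complexConj L) 2)) β' →
        ∀ A B : ℝ≥0, 0 < A → A ≤ B →
          ∫⁻ s : torusInBorel (↥(maximalRealSubfield L)) L (IsCMField.complexConj L) 2, β' s *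
            {s : torusInBorel (↥(maximalRealSubfield L)) L (IsCMField.complexConj L) 2 |
              A < borelHeight (((s : torusInBorel (↥(maximalRealSubfield L)) L (IsCMField.complexConj L) 2) :
                borelAdelic (↥(maximalRealSubfield L)) L (IsCMField.complexConj L) 2) :
                (quasiSplit (↥(maximalRealSubfield L)) L (IsCMField.complexConj L) 2).Adelic) ∧
              borelHeight (((s : torusInBorel (↥(maximalRealSubfield L)) L (IsCMField.complexConj L) 2) :
                borelAdelic (↥(maximalRealSubfield L)) L (IsCMField.complexConj L) 2) :
                (quasiSplit (↥(maximalRealSubfield L)) L (IsCMField.complexConj L) 2).Adelic) ≤ B}.indicator 1 s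
            ∂(Measure.map (⇑(Subgroup.subgroupOfEquivOfLe
              (torusAdelic_le_borelAdelic (F := ↥(maximalRealSubfield L)) (E := L) (c := IsCMField.complexConj L) (N := 2))).symm) ρ :
                Measure (torusInBorel (↥(maximalRealSubfield L)) L (IsCMField.complexConj L) 2)) =
            Cw * ENNReal.ofReal (Real.log (B : ℝ) - Real.log (A : ℝ)))
    {κc : Type} (Bc : κc → ℂ)
    (closerC : ∀ (S : Finset ((AdeleRing (𝓞 L) L)[X] × Bool)) (P : (AdeleRing (𝓞 L) L)[X] × Bool → ℂ[X]),
      (∀ i ∈ S, ∃ T₀ : ℝ≥0, ∀ T : ℝ≥0, T₀ < T →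
      truncatedTraceClass μ ν₀ 𝓕 T
          (fun γ : (quasiSplit (↥(maximalRealSubfield L)) L (IsCMField.complexConj L) 2).arithmeticSubgroup =>
            (((adelicVal (↥(maximalRealSubfield L)) L (IsCMField.complexConj L) 2 _
                (γ : (quasiSplit (↥(maximalRealSubfield L)) L (IsCMField.complexConj L) 2).Adelic) :
                GL (Fin 2) (AdeleRing (𝓞 L) L)) : Matrix (Fin 2) (Fin 2) (AdeleRing (𝓞 L) L)).charpoly,
              decide (∃ δ : (quasiSplit (↥(maximalRealSubfield L)) L (IsCMField.complexConj L) 2).arithmeticSubgroup,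
                δ * γ * δ⁻¹ ∈ arithmeticBorel (↥(maximalRealSubfield L)) L (IsCMField.complexConj L) 2)))
          i f = (P i).eval ((Real.log (T : ℝ) : ℝ) : ℂ)) →
      ∃ zrep : (AdeleRing (𝓞 L) L)[X] × Bool → κc,
        ∑ i ∈ S.filter (fun i : (AdeleRing (𝓞 L) L)[X] × Bool => i.2 = true ∧
            ∃ z : Lˣ, (IsCMField.complexConj L) (z : L) * (z : L) = 1 ∧
              i.1 = ((X - C (z : L)) ^ 2).map (algebraMap L (AdeleRing (𝓞 L) L))), (P i).eval 0 =
          ∑ i ∈ S.filter (fun i : (AdeleRing (𝓞 L) L)[X] × Bool => i.2 = true ∧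
            ∃ z : Lˣ, (IsCMField.complexConj L) (z : L) * (z : L) = 1 ∧
              i.1 = ((X - C (z : L)) ^ 2).map (algebraMap L (AdeleRing (𝓞 L) L))), Bc (zrep i)) :
    haveI := t2Space_quasiSplitAdelic (F := ↥(maximalRealSubfield L)) (E := L) (c := IsCMField.complexConj L) (N := 2)
    haveI := locallyCompactSpace_quasiSplitAdelic (F := ↥(maximalRealSubfield L)) (E := L) (c := IsCMField.complexConj L) (N := 2)
    haveI := secondCountableTopology_quasiSplitAdelic (F := ↥(maximalRealSubfield L)) (E := L) (c := IsCMField.complexConj L) (N := 2)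
    haveI : IsClosed (((quasiSplit (↥(maximalRealSubfield L)) L (IsCMField.complexConj L) 2).quotientSubgroup : Set (quasiSplit (↥(maximalRealSubfield L)) L (IsCMField.complexConj L) 2).Adelic)) :=
      isClosed_quotientSubgroup_quasiSplit
    haveI : ∀ γ : (quasiSplit (↥(maximalRealSubfield L)) L (IsCMField.complexConj L) 2).Adelic, IsClosed ((Subgroup.centralizer ({γ} : Set (quasiSplit (↥(maximalRealSubfield L)) L (IsCMField.complexConj L) 2).Adelic) :
        Subgroup (quasiSplit (↥(maximalRealSubfield L)) L (IsCMField.complexConj L) 2).Adelic) : Set (quasiSplit (↥(maximalRealSubfield L)) L (IsCMField.complexConj L) 2).Adelic) := isClosed_centralizer_quasiSplit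
    haveI : ∀ γ : (quasiSplit (↥(maximalRealSubfield L)) L (IsCMField.complexConj L) 2).Adelic, (count : Measure ↥(((quasiSplit (↥(maximalRealSubfield L)) L (IsCMField.complexConj L) 2).quotientSubgroup ⊓
        Subgroup.centralizer ({γ} : Set (quasiSplit (↥(maximalRealSubfield L)) L (IsCMField.complexConj L) 2).Adelic)).subgroupOf
          (Subgroup.centralizer ({γ} : Set (quasiSplit (↥(maximalRealSubfield L)) L (IsCMField.complexConj L) 2).Adelic)))).IsHaarMeasure :=
      isHaarMeasure_count_inf_centralizer_subgroupOf_quasiSplit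
    haveI : (count : Measure (quasiSplit (↥(maximalRealSubfield L)) L (IsCMField.complexConj L) 2).quotientSubgroup).IsHaarMeasure :=
      isHaarMeasure_count_quotientSubgroup_quasiSplit
    haveI : ν.IsMulRightInvariant := isMulRightInvariant_quasiSplit_cm_two L ν
    letI := AdelicGroupData.measurableSpaceQuotientForm (quasiSplit (↥(maximalRealSubfield L)) L (IsCMField.complexConj L) 2)
    haveI := AdelicGroupData.borelSpaceQuotientForm (quasiSplit (↥(maximalRealSubfield L)) L (IsCMField.complexConj L) 2)
    haveI := AdelicGroupData.smulInvariantMeasureQuotientForm (quasiSplit (↥(maximalRealSubfield L)) L (IsCMField.complexConj L) 2) μ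
    haveI := AdelicGroupData.isFiniteMeasureOnCompactsQuotientForm (quasiSplit (↥(maximalRealSubfield L)) L (IsCMField.complexConj L) 2) μ
    ∃ (zrep : (AdeleRing (𝓞 L) L)[X] × Bool → κc)
      (hyrep : (AdeleRing (𝓞 L) L)[X] × Bool → (quasiSplit (↥(maximalRealSubfield L)) L (IsCMField.complexConj L) 2).Rational),
      ∀ T : ℝ≥0, arthurTrace μ ν₀ 𝓕 f =
        (∑ i ∈ (((finite_setOf_borelRefine_charpoly_of_isCompact (F := ↥(maximalRealSubfield L)) (E := L) (c := IsCMField.complexConj L) (N := 2)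
          hf.hasCompactSupport'.isCompact).toFinset).filter (fun i => ∀ β : ↥(arithmeticBorel (↥(maximalRealSubfield L)) L (IsCMField.complexConj L) 2),
            (((adelicVal (↥(maximalRealSubfield L)) L (IsCMField.complexConj L) 2 _ ((β : ↥(quasiSplit (↥(maximalRealSubfield L)) L (IsCMField.complexConj L) 2).arithmeticSubgroup) : (quasiSplit (↥(maximalRealSubfield L)) L (IsCMField.complexConj L) 2).Adelic) :
                GL (Fin 2) (AdeleRing (𝓞 L) L)) : Matrix (Fin 2) (Fin 2) (AdeleRing (𝓞 L) L)).charpoly,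
              decide (∃ δ : ↥(quasiSplit (↥(maximalRealSubfield L)) L (IsCMField.complexConj L) 2).arithmeticSubgroup, δ * (β : ↥(quasiSplit (↥(maximalRealSubfield L)) L (IsCMField.complexConj L) 2).arithmeticSubgroup) * δ⁻¹ ∈ arithmeticBorel (↥(maximalRealSubfield L)) L (IsCMField.complexConj L) 2)) ≠ i)).attach,
          ((unfoldingConstant (quasiSplit (↥(maximalRealSubfield L)) L (IsCMField.complexConj L) 2).quotientSubgroup
              (count : Measure (quasiSplit (↥(maximalRealSubfield L)) L (IsCMField.complexConj L) 2).quotientSubgroup) μ ν : ℝ) : ℂ) *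
            ∑' s : {s : ConjClasses ↥(quasiSplit (↥(maximalRealSubfield L)) L (IsCMField.complexConj L) 2).arithmeticSubgroup //
                (((adelicVal (↥(maximalRealSubfield L)) L (IsCMField.complexConj L) 2 _ ((rep s : ↥(quasiSplit (↥(maximalRealSubfield L)) L (IsCMField.complexConj L) 2).arithmeticSubgroup) : (quasiSplit (↥(maximalRealSubfield L)) L (IsCMField.complexConj L) 2).Adelic) :
                GL (Fin 2) (AdeleRing (𝓞 L) L)) : Matrix (Fin 2) (Fin 2) (AdeleRing (𝓞 L) L)).charpoly,
              decide (∃ δ : ↥(quasiSplit (↥(maximalRealSubfield L)) L (IsCMField.complexConj L) 2).arithmeticSubgroup, δ * (rep s : ↥(quasiSplit (↥(maximalRealSubfield L)) L (IsCMField.complexConj L) 2).arithmeticSubgroup) * δ⁻¹ ∈ arithmeticBorel (↥(maximalRealSubfield L)) L (IsCMField.complexConj L) 2)) = i.1},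
              (haveI : (νC s.1).IsMulRightInvariant :=
                  isMulRightInvariant_centralizer_of_forall_cl_ne_two
                    (isConjInvariant_borelRefine isConjInvariant_charpoly_adelicVal) (Finset.mem_filter.1 i.2).2 s.2 (νC s.1);
                haveI : (νC s.1).IsInvInvariant :=
                  isInvInvariant_centralizer_of_forall_cl_ne_two
                    (isConjInvariant_borelRefine isConjInvariant_charpoly_adelicVal) (Finset.mem_filter.1 i.2).2 s.2 (νC s.1);
                ((quotientMeasure (((quasiSplit (↥(maximalRealSubfield L)) L (IsCMField.complexConj L) 2).quotientSubgroup ⊓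
                    Subgroup.centralizer ({((rep s.1 : ↥(quasiSplit (↥(maximalRealSubfield L)) L (IsCMField.complexConj L) 2).arithmeticSubgroup) : (quasiSplit (↥(maximalRealSubfield L)) L (IsCMField.complexConj L) 2).Adelic)} : Set (quasiSplit (↥(maximalRealSubfield L)) L (IsCMField.complexConj L) 2).Adelic)).subgroupOf
                    (Subgroup.centralizer ({((rep s.1 : ↥(quasiSplit (↥(maximalRealSubfield L)) L (IsCMField.complexConj L) 2).arithmeticSubgroup) : (quasiSplit (↥(maximalRealSubfield L)) L (IsCMField.complexConj L) 2).Adelic)} : Set (quasiSplit (↥(maximalRealSubfield L)) L (IsCMField.complexConj L) 2).Adelic)))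
                    count (isClosed_inf_centralizer_subgroupOf_quasiSplit _) (νC s.1) Set.univ).toReal : ℂ) *
                  orbitalIntegral ((rep s.1 : ↥(quasiSplit (↥(maximalRealSubfield L)) L (IsCMField.complexConj L) 2).arithmeticSubgroup) : (quasiSplit (↥(maximalRealSubfield L)) L (IsCMField.complexConj L) 2).Adelic) f
                    (quotientMeasure (Subgroup.centralizer ({((rep s.1 : ↥(quasiSplit (↥(maximalRealSubfield L)) L (IsCMField.complexConj L) 2).arithmeticSubgroup) : (quasiSplit (↥(maximalRealSubfield L)) L (IsCMField.complexConj L) 2).Adelic)} : Set (quasiSplit (↥(maximalRealSubfield L)) L (IsCMField.complexConj L) 2).Adelic)) (νC s.1)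
                      (isClosed_centralizer_quasiSplit _) ν))) +
        ((∑ i ∈ ((finite_setOf_borelRefine_charpoly_of_isCompact (F := ↥(maximalRealSubfield L)) (E := L) (c := IsCMField.complexConj L) (N := 2)
          hf.hasCompactSupport'.isCompact).toFinset).filter (fun i : (AdeleRing (𝓞 L) L)[X] × Bool => i.2 = true ∧
            ∃ z : Lˣ, (IsCMField.complexConj L) (z : L) * (z : L) = 1 ∧
              i.1 = ((X - C (z : L)) ^ 2).map (algebraMap L (AdeleRing (𝓞 L) L))),
            Bc (zrep i)) +
          (∑ i ∈ ((finite_setOf_borelRefine_charpoly_of_isCompact (F := ↥(maximalRealSubfield L)) (E := L) (c := IsCMField.complexConj L) (N := 2)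
          hf.hasCompactSupport'.isCompact).toFinset).filter (fun i : (AdeleRing (𝓞 L) L)[X] × Bool => i.2 = true ∧
            ∃ a : Lˣ, (IsCMField.complexConj L) (a : L) * (a : L) ≠ 1 ∧
              i.1 = ((X - C (a : L)) * (X - C ((IsCMField.complexConj L) (a : L))⁻¹)).map (algebraMap L (AdeleRing (𝓞 L) L))),
            -(((unfoldingConstant (quasiSplit (↥(maximalRealSubfield L)) L (IsCMField.complexConj L) 2).quotientSubgroup
                (count : Measure (quasiSplit (↥(maximalRealSubfield L)) L (IsCMField.complexConj L) 2).quotientSubgroup) μ ν : ℝ) : ℂ) *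
              (Cw.toReal : ℂ) *
              ∫ x : (quasiSplit (↥(maximalRealSubfield L)) L (IsCMField.complexConj L) 2).Adelic ⧸
                  torusAdelic (↥(maximalRealSubfield L)) L (IsCMField.complexConj L) 2,
                f ((x.out : (quasiSplit (↥(maximalRealSubfield L)) L (IsCMField.complexConj L) 2).Adelic) *
                    (quasiSplit (↥(maximalRealSubfield L)) L (IsCMField.complexConj L) 2).toAdelic (hyrep i) *
                    (x.out : (quasiSplit (↥(maximalRealSubfield L)) L (IsCMField.complexConj L) 2).Adelic)⁻¹) *
                  ((Real.log (borelHeight (x.out : (quasiSplit (↥(maximalRealSubfield L)) L (IsCMField.complexConj L) 2).Adelic)⁻¹) +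
                    Real.log (borelHeight ((quasiSplit (↥(maximalRealSubfield L)) L (IsCMField.complexConj L) 2).toAdelic w *
                      (x.out : (quasiSplit (↥(maximalRealSubfield L)) L (IsCMField.complexConj L) 2).Adelic)⁻¹)) : ℝ) : ℂ)
                ∂(quotientMeasure (torusAdelic (↥(maximalRealSubfield L)) L (IsCMField.complexConj L) 2) ρ isClosed_torusAdelic ν)))) := by
  have hsock :=
    arthurTrace_eq_sum_orbital_add_sum_central_add_sum_hyperbolic_cm_two L ν μ ν₀ 𝓕 h𝓕 rep hrep νC f hf
  cases hsock with
  | intro P hrest =>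
    have hP := hrest.2.1
    have hJ := hrest.2.2.2.2
    have hzE := closerC _ P hP
    have hhE := exists_rep_sum_filter_hyperbolic_classPolynomial_eval_zero_cm_two L μ ν ρ ν₀ 𝓕 h𝓕 hw hf hC hwin _ P hP
    cases hzE with
    | intro zrep hz =>
      cases hhE with
      | intro hyrep hh3 =>
        have hh := hh3.2.2
        refine ⟨zrep, hyrep, fun T => (hJ T).trans ?_⟩
        exact congrArg (HAdd.hAdd _) (congrArg₂ HAdd.hAdd hz hh)

end UnitaryGroup

end Literature.NumberTheory.Automorphic

end
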